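import Literature.MathematicalPhysics.QuantumFieldTheory.Balaban1983to89.B7Prop5Flat
import Summits.QuantumFields.BalabanUV.T4Continuum.Support.ShellMeasureLandauCorrectionB7

/-!
# [B7] THE PRINTED LOCALITY OF THE COVARIANT AVERAGES (89)∕(91) AND (148) AT A GENERAL REGULAR BACKGROUND, PER COARSE BOND, IN
# THE `Q″`-CURRENCY (`ShellMeasureAverageLocality148`)

Audit cell `pub-balaban`, `t4`, NE7c ROUND-2 crew seat `b2b-balaban-t4-ne7c-formalise-leaf-04` gen 5; OFFER + CLAIM journal l.15816
(unbooked, additive).  Item = letter **(P5-b)** of leaf-10-g9's PROPOSITION-5 cut (l.15650, assigned there to no lineage): «(148) at a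
general background in the `Q″`-currency = `B7Ineq148.ineq148Printed_of_123` fed with S55's (123) pair on b07's insertion space per
coarse bond; the LOCALITY «Q(V₀, A, c) depends only on A_b, b ⊂ B(c₋) ∪ B(c₊)» of (89) is needed as a lemma».  This file is the
GENERAL-BACKGROUND TWIN of §1–§2 of b07's `B7Prop5Flat` (`dbavg_congr`, `oneC_congr`, `logIter_congr`, `oneC_eq_ins`, `ineq148_flat` at
`U₀ = 1`) for the covariant objects `B7Eq92Concrete.dbavgCov` (89), `B7Prop3GeneralLinear.Qcov`∕`linQcov`∕`Ccov` (121)–(122),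
`B7Prop4GeneralLevels.logCovIter`∕`linCovIter` (91)∕(127) that rows S55∕S56∕S64 use.  INPUTS BY NAME (none restated): `B7Prop1Local`
(`AgreeOn` boxes, `hol_treeWord_congr`, `bavg_congr`, `avgIter_congr` = the printed locality of (42)∕(43)), `B7Prop5Flat` (`BondIn`,
`bondsIn`, `restr`, `S1`, `inBox_nest`, …), row S55's `B7Prop3GeneralAnalytic.prop3_general_analyticAt_of_le_c3` and
`ShellMeasureAverageProp3Discharge.h3rem_discharge`∕`loopReg_of_pdev` ((121)∕(123) at a general background, `C₁ = 131072(d+1)² =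
C1cov d`), `B7Ineq148` (pv23: `dPair` (137), `Qpp` (140), `Ineq148Printed`, `ineq148Printed_of_123`), row S64's
`ShellMeasureLandauCorrectionB7.landauCf`∕`scaleIns` (END-II's `Cf`).

WHAT IS PRINTED ([Balaban1985Averaging]; journal page = PDF page + 16).  p. 24 (after (43)): «this definition is local in the sense
that Ū^k_c, c ⊂ Ω^{(k)}, depends only on the bond variables U_b for b ⊂ B^k(c₋) ∪ B^k(c₊).»  p. 31 (after (91)): «these averages
have the same locality properties as the averages Ū^k, namely (U̿₁^k)_c, c ∈ Ω^{(k)}, …».  p. 34: «(V̿₁)_c is an analytic function of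
the variables A_b, b ⊂ B(c₋) ∪ B(c₊)».  p. 39 (140): «(Q″A)_c = Σ_{b ⊂ B(c₋)∪B(c₊)} L^{−d} A_b».  p. 40 (148): «For one-step
renormalization transformation we have the bound |⟨δC(V₀, A)∕δA, δA⟩| ≤ C″₁|A|Q″|δA| (148) following easily from general properties
of the function C(V₀, A). The constant C″₁ depends on d and L.»

WHAT THIS FILE PROVES (kernel, 0 sorry, 0 def; `𝔸` a complete normed `ℂ`-algebra, e.g. `M_N(ℂ)`).  §1 LOCALITY AT A GENERAL
BACKGROUND (group algebra, NO smallness, `L ≥ 1`): `tHol_treeWord_congr` ((58)), `Fcov_congr`∕`wframe_congr` ((82)), `tild_congr`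
((65)), **`dbavgCov_congr`** ((89): `V̿₁(c)` depends on the PAIR `(V₀, V₁)` only through the bonds of `[q, bondHi L q κ] =
B(c₋) ∪ B(c₊)`), hence **`Qcov_congr`**, **`linQcov_congr`**, **`Ccov_congr`**; the `k`-fold twins **`logCovIter_congr`** ∕
**`linCovIter_congr`** ((91)∕(127), BACKGROUND INCLUDED via `avgIter_congr`); `Ccov_eq_ins`.  §2 **(148) AT A GENERAL REGULAR
BACKGROUND ON THE INSERTION SPACE** (`ineq148_general`): for EVERY finite bond set `S`, every unit-bounded `V₀` with
`pdev V₀ < β ≤ 1∕(1024(d+1)(d+4)L²)` (row S55's regime) and every `L`-bond: `Ineq148Printed (a ↦ C(V₀, ins_S a, c)) L d (c₃(d,L)∕4)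
(4·C₁·L^{d+2})` — constants EXPLICIT, uniform in `V₀`, `S`, `β` (over `analyticOnNhd_Qcov_insCfg`, `linQcov_insCfg_eq_fderiv`,
`differentiableOn_Ccov_insCfg`, `norm_Ccov_insCfg_le`).  §3 **(148) VERBATIM FOR FIELDS ON THE WHOLE LATTICE**
(`ineq148_general_global`): the differential (137) of `A ↦ C(V₀, A, c)` sees `δA` only on `B(c₋) ∪ B(c₊)` and is bounded by
`C″₁·a·Σ_{b ⊂ B(c₋)∪B(c₊)} L^{−d}‖δA_b‖` for `‖A_b‖ ≤ a < c₃∕4` there — (140)'s `Q″` summed over EXACTLY `b ⊂ B(c₋) ∪ B(c₊)`.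
§4 **END-II's `Cf` IS BLOCK-LOCAL** (`landauCf_congr`, `dPair_landauCf_apply_eq_zero`, `fderiv_landauCf_apply_single_eq_zero`): row
S64's `landauCf L U₀ k S S′ A (c)` depends on `A_b` only for `b ⊂ B^k(c₋) ∪ B^k(c₊)`; the entry `(c, b)` of its derivative VANISHES
off that box — the exact-support half of the pseudo-locality [Balaban1985Variational] (73) displays (leaf-08-g12, l.15555, treats the
decay half).  NOT DONE (said, not claimed): (139)∕(147) in majorant form at a general background (P5-a), the `k`-fold induction
(149)–(157) (P5-c), the junction into the (72)-binder (P5-d), the `η^d` display of (138).  HONEST (c3): B7-level bookkeeping on OUR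
side of WALL §2 (a); NOTHING in the countdown moves; «NE7c ⇐ the named binders»; NE7c NOT PRINTED, NOT PROVED; spine PROVED 0∕9;
rung (B)+1 on a FINITE T⁴ — NOT infinite volume, NOT mass gap, NOT Clay.  HONEST DEPENDENCY: continuum YM on T⁴ ⇐ BetaPertH ∧ nine
spine estimates (0/9 proved); BetaPertH ⇐ (D1) ∧ (D4) ∧ CAP+tail; G-an2-4 gates asym, D1 and NE2/3/4.
-/

noncomputable section

open scoped BigOperators
open NormedSpace Finset Metric

namespace Summit.QuantumFields.BalabanUV.T4Continuum.ShellMeasureAverageLocality148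

open Literature.MathematicalPhysics.QuantumFieldTheory.Balaban1983to89
open B7Prop1Explicit (Site e hol treeWord boxVec bavg U1)
open B7Prop2Explicit (avgIter pdev)
open B7Prop3Flat (expCfg insCfg c3 c3_pos insCfg_smul norm_insCfg_le analyticAt_insCfg)
open B7Prop1Local (InBox AgreeOn bondHi loK bondHiK hol_treeWord_congr bavg_congr avgIter_congr add_zsmul_e_apply
  add_e_apply)
open B7Eq92Concrete (Rc tHol Fcov wframe tild dbavgCov dbavgCov_apply tild_apply)
open B7Prop3GeneralLinear (Qcov linQcov Ccov)
open B7Prop3GeneralAnalytic (prop3_general_analyticAt_of_le_c3)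
open B7Prop4GeneralLevels (logCovIter linCovIter logCovIter_succ linCovIter_succ)
open B7Prop5Flat (BondIn bondsIn mem_bondsIn restr S1 agreeOn_expCfg agreeOn_insCfg_restr inBox_nest)
open B7Ineq148 (dPair Qpp Qpp_nonneg Ineq148Printed ineq148Printed_of_123 dPair_eq_fderiv)
open MatrixLog (mlog)
open ShellMeasureAverageProp4General (C1cov C1cov_pos)
open ShellMeasureAverageProp3Discharge (loopReg_of_pdev h3rem_discharge)
open ShellMeasureLandauCorrectionB7 (scaleIns landauCf)

variable {d : ℕ}

/-! ## §1 Locality of the covariant one-step objects (58), (82), (65), (89), (121)–(122) and of the composites (91)∕(127) -/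

section Group

variable {G : Type*}

/-- Agreement of a configuration with itself. [folklore] -/
theorem agreeOn_rfl {lo hi : Site d} {V : Site d → Fin d → G} : AgreeOn lo hi V V := fun _ _ _ _ => rfl

variable [Group G]

/-- Agreement on the bonds of a box is inherited by pointwise products (`V₁V₀`). [folklore] -/
theorem agreeOn_mul {lo hi : Site d} {V V' W W' : Site d → Fin d → G} (hV : AgreeOn lo hi V V')
    (hW : AgreeOn lo hi W W') : AgreeOn lo hi (V * W) (V' * W') := fun x κ hx hx' => by
  simp only [Pi.mul_apply, hV x κ hx hx', hW x κ hx hx']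

/-- **LOCALITY OF THE TWISTED TRANSPORT (58)** `(R_{0,y}V₁)(Γ_{y,y+r}) = (V₁V₀)(Γ)·V₀(Γ)⁻¹` along the tree contour inside a box
containing `y`, `y + r`: it sees the PAIR `(V₀, V₁)` only through the bonds of the box. [cite: Balaban1985Averaging, (58) p.27, p.24 (after (43))] -/
theorem tHol_treeWord_congr {lo hi : Site d} {V₀ V₀' V₁ V₁' : Site d → Fin d → G} (h₀ : AgreeOn lo hi V₀ V₀')
    (h₁ : AgreeOn lo hi V₁ V₁') (y r : Site d) (hy : InBox lo hi y) (hyr : InBox lo hi (y + r)) :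
    tHol V₀ V₁ y (treeWord r) = tHol V₀' V₁' y (treeWord r) := by
  unfold tHol
  rw [hol_treeWord_congr (agreeOn_mul h₁ h₀) y r hy hyr, hol_treeWord_congr h₀ y r hy hyr]

end Group

section Covariant

variable {𝔸 : Type*} [NormedRing 𝔸] [NormedAlgebra ℂ 𝔸] [CompleteSpace 𝔸]

omit [NormedRing 𝔸] [NormedAlgebra ℂ 𝔸] [CompleteSpace 𝔸] in
/-- Box arithmetic: the block `B(y) = y + [0, L)^d` lies in `[lo, hi]` when `y` does and `y + (L−1)𝟙 ≤ hi`. [folklore] -/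
theorem inBox_add_boxVec {lo hi : Site d} {L : ℕ} {y : Site d} (hy : InBox lo hi y)
    (hyL : ∀ i, y i + ((L : ℤ) - 1) ≤ hi i) (r : Fin d → Fin L) : InBox lo hi (y + boxVec L r) := fun i => by
  have hr : 0 ≤ boxVec L r i ∧ boxVec L r i + 1 ≤ L :=
    ⟨by simp [boxVec], by have := (r i).isLt; simp only [boxVec]; omega⟩
  have := hy i; have := hyL i
  simp only [Pi.add_apply]
  constructor <;> omega

omit [CompleteSpace 𝔸] in
/-- **LOCALITY OF THE FRAME EXPONENT (82)∕(62)** `F(y) = Σ_{x∈B(y)} L^{−d} log (R_{0,y}V₁)(Γ_{y,x})` at a general background: it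
depends on `(V₀, V₁)` only through the bonds of `B(y)`, hence of any box containing it. [cite: Balaban1985Averaging, (82) p.30, p.31 (after (91))] -/
theorem Fcov_congr (L : ℕ) {lo hi : Site d} {V₀ V₀' V₁ V₁' : Site d → Fin d → 𝔸ˣ} (h₀ : AgreeOn lo hi V₀ V₀')
    (h₁ : AgreeOn lo hi V₁ V₁') (y : Site d) (hy : InBox lo hi y) (hyL : ∀ i, y i + ((L : ℤ) - 1) ≤ hi i) :
    Fcov L V₀ V₁ y = Fcov L V₀' V₁' y := by
  unfold Fcov
  refine Finset.sum_congr rfl fun r _ => ?_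
  rw [tHol_treeWord_congr h₀ h₁ y (boxVec L r) hy (inBox_add_boxVec hy hyL r)]

/-- **LOCALITY OF THE BLOCK FRAME `\overline{R_{0,y}V₁} = exp F(y)` (82)** at a general background. [cite: Balaban1985Averaging, (82) p.30, p.31 (after (91))] -/
theorem wframe_congr (L : ℕ) {lo hi : Site d} {V₀ V₀' V₁ V₁' : Site d → Fin d → 𝔸ˣ} (h₀ : AgreeOn lo hi V₀ V₀')
    (h₁ : AgreeOn lo hi V₁ V₁') (y : Site d) (hy : InBox lo hi y) (hyL : ∀ i, y i + ((L : ℤ) - 1) ≤ hi i) :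
    wframe L V₀ V₁ y = wframe L V₀' V₁' y := by
  unfold wframe
  rw [Fcov_congr L h₀ h₁ y hy hyL]

/-- **LOCALITY OF `Ṽ₁(c) = (\overline{V₁V₀})_c(V̄₀)_c⁻¹` (65)**: the pair `(V₀, V₁)` enters only through the bonds of `B(c₋) ∪ B(c₊)`
(`B7Prop1Local.bavg_congr`, twice). [cite: Balaban1985Averaging, (65) p.29, p.24 (after (43))] -/
theorem tild_congr (L : ℕ) (hL : 1 ≤ L) (q : Site d) (κ : Fin d) {V₀ V₀' V₁ V₁' : Site d → Fin d → 𝔸ˣ}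
    (h₀ : AgreeOn q (bondHi L q κ) V₀ V₀') (h₁ : AgreeOn q (bondHi L q κ) V₁ V₁') :
    tild L V₀ V₁ q κ = tild L V₀' V₁' q κ := by
  rw [tild_apply, tild_apply, bavg_congr L hL q κ (agreeOn_mul h₁ h₀), bavg_congr L hL q κ h₀]

/-- **LOCALITY OF THE COVARIANT DOUBLE-BAR AVERAGE `V̿₁(c)` (89) AT A GENERAL BACKGROUND** — p. 31: (89)–(91) «have the same
locality properties as the averages Ū^k» (p. 24: «depends only on the bond variables U_b for b ⊂ B(c₋) ∪ B(c₊)»): two PAIRS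
`(V₀, V₁)`, `(V₀′, V₁′)` agreeing on the bonds of `[q, q + (L−1)𝟙 + Le_κ] = B(c₋) ∪ B(c₊)` have the same `V̿₁(c)`, `c = ⟨q, q + Le_κ⟩`
(`B7Prop5Flat.dbavg_congr` is the case `V₀ = V₀′ = 1`). [cite: Balaban1985Averaging, p.31 (after (91)), (89) p.31, p.24 (after (43))] -/
theorem dbavgCov_congr (L : ℕ) (hL : 1 ≤ L) (q : Site d) (κ : Fin d) {V₀ V₀' V₁ V₁' : Site d → Fin d → 𝔸ˣ}
    (h₀ : AgreeOn q (bondHi L q κ) V₀ V₀') (h₁ : AgreeOn q (bondHi L q κ) V₁ V₁') :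
    dbavgCov L V₀ V₁ q κ = dbavgCov L V₀' V₁' q κ := by
  have hq : InBox q (bondHi L q κ) q := fun i => by simp only [bondHi]; split_ifs <;> omega
  have hqL : InBox q (bondHi L q κ) (q + (L : ℤ) • e κ) := fun i => by
    simp only [bondHi, add_zsmul_e_apply]; split_ifs <;> omega
  have h1 : ∀ i, q i + ((L : ℤ) - 1) ≤ bondHi L q κ i := fun i => by simp only [bondHi]; split_ifs <;> omega
  have h2 : ∀ i, (q + (L : ℤ) • e κ) i + ((L : ℤ) - 1) ≤ bondHi L q κ i := fun i => by
    simp only [bondHi, add_zsmul_e_apply]; split_ifs <;> omega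
  rw [dbavgCov_apply, dbavgCov_apply, wframe_congr L h₀ h₁ q hq h1, wframe_congr L h₀ h₁ _ hqL h2,
    tild_congr L hL q κ h₀ h₁, bavg_congr L hL q κ h₀]

omit [CompleteSpace 𝔸] in
/-- Agreement on the bonds of a box is inherited by complex multiples (the ray `tA` of (122)). [folklore] -/
theorem agreeOn_smul {lo hi : Site d} {A A' : Site d → Fin d → 𝔸} (h : AgreeOn lo hi A A') (t : ℂ) :
    AgreeOn lo hi (t • A) (t • A') := fun x κ hx hx' => by
  simp only [Pi.smul_apply, h x κ hx hx']

/-- **LOCALITY OF `Q(V₀, A, c) = (1∕i) log V̿₁(c)` (121)** in the background and the field. [cite: Balaban1985Averaging, (121) p.36, p.34, p.31 (after (91))] -/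
theorem Qcov_congr (L : ℕ) (hL : 1 ≤ L) (q : Site d) (κ : Fin d) {V₀ V₀' : Site d → Fin d → 𝔸ˣ}
    {A A' : Site d → Fin d → 𝔸} (h₀ : AgreeOn q (bondHi L q κ) V₀ V₀') (hA : AgreeOn q (bondHi L q κ) A A') :
    Qcov L V₀ A q κ = Qcov L V₀' A' q κ := by
  unfold Qcov
  rw [dbavgCov_congr L hL q κ h₀ (agreeOn_expCfg hA)]

/-- **LOCALITY OF THE LINEAR PART «L(Q(V₀)A)_c» (122)** (a ray of local functions is local). [cite: Balaban1985Averaging, (122) p.36, p.34] -/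
theorem linQcov_congr (L : ℕ) (hL : 1 ≤ L) (q : Site d) (κ : Fin d) {V₀ V₀' : Site d → Fin d → 𝔸ˣ}
    {A A' : Site d → Fin d → 𝔸} (h₀ : AgreeOn q (bondHi L q κ) V₀ V₀') (hA : AgreeOn q (bondHi L q κ) A A') :
    linQcov L V₀ A q κ = linQcov L V₀' A' q κ := by
  unfold linQcov
  have h : (fun t : ℂ => Qcov L V₀ (t • A) q κ) = fun t : ℂ => Qcov L V₀' (t • A') q κ :=
    funext fun t => Qcov_congr L hL q κ h₀ (agreeOn_smul hA t)
  rw [h]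

/-- **LOCALITY OF THE ONE-STEP REMAINDER `C(V₀, A, c)` (122)** at a general background — the lemma letter (P5-b) asks for:
«Q(V₀, A, c) depends only on A_b, b ⊂ B(c₋) ∪ B(c₊)», and so does `C = Q − L(Q(V₀)·)`. [cite: Balaban1985Averaging, (122) p.36, p.34, p.31 (after (91))] -/
theorem Ccov_congr (L : ℕ) (hL : 1 ≤ L) (q : Site d) (κ : Fin d) {V₀ V₀' : Site d → Fin d → 𝔸ˣ}
    {A A' : Site d → Fin d → 𝔸} (h₀ : AgreeOn q (bondHi L q κ) V₀ V₀') (hA : AgreeOn q (bondHi L q κ) A A') :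
    Ccov L V₀ A q κ = Ccov L V₀' A' q κ := by
  unfold Ccov
  rw [Qcov_congr L hL q κ h₀ hA, linQcov_congr L hL q κ h₀ hA]

/-- **LOCALITY OF THE COMPOSITE `Q_j(U₀, ·)(c)` (91)∕(127)**, BACKGROUND INCLUDED (p. 31 «(U̿₁^k)_c … the same locality properties
as the averages Ū^k»): pairs `(U₀, B)`, `(U₀′, B′)` agreeing on the bonds of `[Lʲz, Lʲz + (Lʲ − 1)𝟙 + Lʲe_κ]` give the same `Q_j` at
`⟨Lʲz, Lʲz + Lʲe_κ⟩` (level backgrounds by `avgIter_congr`). [cite: Balaban1985Averaging, p.31 (after (91)), p.24 (after (43)), (127) p.37] -/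
theorem logCovIter_congr (L : ℕ) (hL : 1 ≤ L) :
    ∀ (j : ℕ) {U₀ U₀' : Site d → Fin d → 𝔸ˣ} {B B' : Site d → Fin d → 𝔸} (z : Site d) (κ : Fin d),
      AgreeOn (loK L j z) (bondHiK L j z κ) U₀ U₀' → AgreeOn (loK L j z) (bondHiK L j z κ) B B' →
      logCovIter L U₀ B j z κ = logCovIter L U₀' B' j z κ
  | 0, U₀, U₀', B, B', z, κ, _, h => by
    refine h z κ (fun i => ?_) (fun i => ?_)
    · simp only [loK, bondHiK, pow_zero, one_mul]; split_ifs <;> omega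
    · simp only [loK, bondHiK, pow_zero, one_mul, add_e_apply]; split_ifs <;> omega
  | j + 1, U₀, U₀', B, B', z, κ, hU, h => by
    rw [logCovIter_succ, logCovIter_succ]
    refine Qcov_congr L hL _ κ (fun x μ hx hxe => ?_) (fun x μ hx hxe => ?_)
    · exact avgIter_congr L hL j x μ fun p ν hp hpν =>
        hU p ν (inBox_nest L j z κ ⟨hx, hxe⟩ hp) (inBox_nest L j z κ ⟨hx, hxe⟩ hpν)
    · exact logCovIter_congr L hL j x μ
        (fun p ν hp hpν => hU p ν (inBox_nest L j z κ ⟨hx, hxe⟩ hp) (inBox_nest L j z κ ⟨hx, hxe⟩ hpν))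
        (fun p ν hp hpν => h p ν (inBox_nest L j z κ ⟨hx, hxe⟩ hp) (inBox_nest L j z κ ⟨hx, hxe⟩ hpν))

/-- **LOCALITY OF THE COMPOSED LINEAR PART «LʲηQ_j(U₀)» (127)** (p. 38 «Q_{j+1}(U₀) = Q(Ū₀ʲ)Q_j(U₀)»), background included.
[cite: Balaban1985Averaging, p.38 (before (133)), p.31 (after (91)), p.24 (after (43))] -/
theorem linCovIter_congr (L : ℕ) (hL : 1 ≤ L) :
    ∀ (j : ℕ) {U₀ U₀' : Site d → Fin d → 𝔸ˣ} {B B' : Site d → Fin d → 𝔸} (z : Site d) (κ : Fin d),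
      AgreeOn (loK L j z) (bondHiK L j z κ) U₀ U₀' → AgreeOn (loK L j z) (bondHiK L j z κ) B B' →
      linCovIter L U₀ B j z κ = linCovIter L U₀' B' j z κ
  | 0, U₀, U₀', B, B', z, κ, _, h => by
    refine h z κ (fun i => ?_) (fun i => ?_)
    · simp only [loK, bondHiK, pow_zero, one_mul]; split_ifs <;> omega
    · simp only [loK, bondHiK, pow_zero, one_mul, add_e_apply]; split_ifs <;> omega
  | j + 1, U₀, U₀', B, B', z, κ, hU, h => by
    rw [linCovIter_succ, linCovIter_succ]
    refine linQcov_congr L hL _ κ (fun x μ hx hxe => ?_) (fun x μ hx hxe => ?_)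
    · exact avgIter_congr L hL j x μ fun p ν hp hpν =>
        hU p ν (inBox_nest L j z κ ⟨hx, hxe⟩ hp) (inBox_nest L j z κ ⟨hx, hxe⟩ hpν)
    · exact linCovIter_congr L hL j x μ
        (fun p ν hp hpν => hU p ν (inBox_nest L j z κ ⟨hx, hxe⟩ hp) (inBox_nest L j z κ ⟨hx, hxe⟩ hpν))
        (fun p ν hp hpν => h p ν (inBox_nest L j z κ ⟨hx, hxe⟩ hp) (inBox_nest L j z κ ⟨hx, hxe⟩ hpν))

omit [CompleteSpace 𝔸] in
/-- Restriction to the coordinates `𝔸^S` is linear along lines: `(A + tδA)|_S = A|_S + t·δA|_S`. [folklore] -/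
theorem restr_add_smul (S : Finset (Site d × Fin d)) (A δA : Site d → Fin d → 𝔸) (t : ℂ) :
    restr S (A + t • δA) = restr S A + t • restr S δA := rfl

/-- **`C(V₀, A, c)` IS A FUNCTION OF THE FINITELY MANY VARIABLES `A_b`, `b ⊂ B(c₋) ∪ B(c₊)`** (p. 34): it equals the
`𝔸^{S1}`-function `a ↦ C(V₀, ins_{S1} a, c)` at the restriction `A|_{S1}` (twin of `B7Prop5Flat.oneC_eq_ins`). [cite: Balaban1985Averaging, p.34, (122) p.36] -/
theorem Ccov_eq_ins (L : ℕ) (hL : 1 ≤ L) (V₀ : Site d → Fin d → 𝔸ˣ) (A : Site d → Fin d → 𝔸) (q : Site d) (κ : Fin d) :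
    Ccov L V₀ A q κ = Ccov L V₀ (insCfg (S1 L q κ) (restr (S1 L q κ) A)) q κ :=
  Ccov_congr L hL q κ agreeOn_rfl (agreeOn_insCfg_restr q (bondHi L q κ) A)

end Covariant

/-! ## §2 (148) at a general regular background, on the insertion space `𝔸^S` -/

section Ineq148

variable {𝔸 : Type*} [NormedRing 𝔸] [NormedAlgebra ℂ 𝔸] [CompleteSpace 𝔸] [NormOneClass 𝔸]
variable {L : ℕ} (hL : 1 ≤ L) {V₀ : Site d → Fin d → 𝔸ˣ} (hV₀ : ∀ x κ, V₀ x κ ∈ U1 𝔸) {β : ℝ} (hβ0 : 0 ≤ β)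
  (hβ : pdev V₀ < β) (hβmax : β ≤ 1 / (1024 * ((d : ℝ) + 1) * ((d : ℝ) + 4) * (L : ℝ) ^ 2))
include hL hV₀ hβ0 hβ hβmax

/-- **Prop. 3's analyticity through the insertion**: in the regime (whence `α`-regular block contours at every `L`-bond,
`loopReg_of_pdev`) and for every finite bond set `S`, `a ↦ Q(V₀, ins_S a, c)` is analytic on a neighbourhood of every point of the
polydisc `‖a‖ < c₃(d, L)` (row S55's `prop3_general_analyticAt_of_le_c3` BY NAME along `insCfg`). [cite: Balaban1985Averaging, Proposition 3 (121) p.36, p.34] -/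
theorem analyticOnNhd_Qcov_insCfg (S : Finset (Site d × Fin d)) (q : Site d) (κ : Fin d) :
    AnalyticOnNhd ℂ (fun a : S → 𝔸 => Qcov L V₀ (insCfg S a) q κ) (ball 0 (c3 d L)) := fun a₀ ha => by
  obtain ⟨hreg, hα1⟩ := loopReg_of_pdev hL hV₀ hβ0 hβ hβmax q κ
  rw [mem_ball_zero_iff] at ha
  show AnalyticAt ℂ (fun a : S → 𝔸 => mlog ((dbavgCov L V₀ (expCfg (insCfg S a)) q κ : 𝔸ˣ) : 𝔸)) a₀
  exact prop3_general_analyticAt_of_le_c3 (fun a : S → 𝔸 => insCfg S a) (fun x μ => analyticAt_insCfg S x μ a₀)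
    hL hV₀ (norm_nonneg a₀) (fun x μ => norm_insCfg_le S a₀ x μ) ha.le q κ hα1 hreg

/-- **The linear part through the insertion IS the Fréchet derivative at `0`**: `L(Q(V₀) ins_S a)_c = D[a ↦ Q(V₀, ins_S a, c)](0)·a`
(the ray `ins_S(ta) = t·ins_S a` and the chain rule). [cite: Balaban1985Averaging, (122) p.36] -/
theorem linQcov_insCfg_eq_fderiv (S : Finset (Site d × Fin d)) (q : Site d) (κ : Fin d) (a : S → 𝔸) :
    linQcov L V₀ (insCfg S a) q κ = fderiv ℂ (fun a : S → 𝔸 => Qcov L V₀ (insCfg S a) q κ) 0 a := by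
  have hd : DifferentiableAt ℂ (fun a : S → 𝔸 => Qcov L V₀ (insCfg S a) q κ) 0 :=
    (analyticOnNhd_Qcov_insCfg hL hV₀ hβ0 hβ hβmax S q κ 0 (mem_ball_self (c3_pos d hL))).differentiableAt
  rw [← dPair_eq_fderiv hd]
  unfold linQcov dPair
  have h : (fun t : ℂ => Qcov L V₀ (t • insCfg S a) q κ) = fun t : ℂ => Qcov L V₀ (insCfg S ((0 : S → 𝔸) + t • a)) q κ :=
    funext fun t => by rw [zero_add, insCfg_smul]
  rw [h]

/-- **`a ↦ C(V₀, ins_S a, c)` is `ℂ`-differentiable on the polydisc `‖a‖ < c₃(d, L)`** (analytic `Q` minus its linear part, which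
through the insertion is the continuous linear map `D[Q ∘ ins_S](0)`). [cite: Balaban1985Averaging, Proposition 3 (121)–(122) p.36] -/
theorem differentiableOn_Ccov_insCfg (S : Finset (Site d × Fin d)) (q : Site d) (κ : Fin d) :
    DifferentiableOn ℂ (fun a : S → 𝔸 => Ccov L V₀ (insCfg S a) q κ) (ball 0 (c3 d L)) := by
  have h : (fun a : S → 𝔸 => linQcov L V₀ (insCfg S a) q κ)
      = fun a => fderiv ℂ (fun a : S → 𝔸 => Qcov L V₀ (insCfg S a) q κ) 0 a :=
    funext fun a => linQcov_insCfg_eq_fderiv hL hV₀ hβ0 hβ hβmax S q κ a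
  have hlin : Differentiable ℂ (fun a : S → 𝔸 => linQcov L V₀ (insCfg S a) q κ) := by
    rw [h]; exact (fderiv ℂ (fun a : S → 𝔸 => Qcov L V₀ (insCfg S a) q κ) 0).differentiable
  show DifferentiableOn ℂ (fun a : S → 𝔸 => Qcov L V₀ (insCfg S a) q κ - linQcov L V₀ (insCfg S a) q κ) (ball 0 (c3 d L))
  exact (analyticOnNhd_Qcov_insCfg hL hV₀ hβ0 hβ hβmax S q κ).differentiableOn.sub hlin.differentiableOn

/-- **(123) ON THE INSERTION SPACE at a general regular background**: `‖C(V₀, ins_S a, c)‖ ≤ C₁L²‖a‖²` for `‖a‖ ≤ c₃(d, L)∕2`,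
`C₁ = 131072(d+1)²` — row S55's `h3rem_discharge` BY NAME at the inserted field. [cite: Balaban1985Averaging, Proposition 3 (123) p.36] -/
theorem norm_Ccov_insCfg_le (S : Finset (Site d × Fin d)) (q : Site d) (κ : Fin d) {a : S → 𝔸} (ha : ‖a‖ ≤ c3 d L / 2) :
    ‖Ccov L V₀ (insCfg S a) q κ‖ ≤ C1cov d * (L : ℝ) ^ 2 * ‖a‖ ^ 2 := by
  have h := h3rem_discharge (d := d) hL (le_refl (U1 𝔸)) V₀ β hV₀ hβ0 hβ hβmax (insCfg S a) ‖a‖ (norm_nonneg a) ha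
    (fun x μ => norm_insCfg_le S a x μ) q κ
  unfold Ccov C1cov
  exact h

/-- **(148) AT A GENERAL REGULAR BACKGROUND, ON THE INSERTION SPACE** — p. 40 «|⟨δC(V₀, A)∕δA, δA⟩| ≤ C″₁|A|Q″|δA| … The constant C″₁
depends on d and L»: for `C = C(V₀, ·, c)` read on `𝔸^S`, ANY finite `S`, ANY unit-bounded background with `pdev V₀ < β ≤
1∕(1024(d+1)(d+4)L²)`: `Ineq148Printed` with radius `c₃(d, L)∕4`, `C″₁ = 4·C₁·L^{d+2}`, `C₁ = 131072(d+1)²` (pv23's Cauchy estimate fed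
with row S55's Prop. 3; `B7Prop5Flat.ineq148_flat` is the case `V₀ = 1`). [cite: Balaban1985Averaging, (148) p.40, Proposition 3 (121)–(123) p.36] -/
theorem ineq148_general (S : Finset (Site d × Fin d)) (q : Site d) (κ : Fin d) :
    Ineq148Printed (fun a : S → 𝔸 => Ccov L V₀ (insCfg S a) q κ) (L : ℝ) d (c3 d L / 4)
      (4 * C1cov d * (L : ℝ) ^ (d + 2)) := by
  have hL0 : (0 : ℝ) < L := by exact_mod_cast hL
  have h := ineq148Printed_of_123 (d := d) (c₃ := c3 d L / 2) hL0 (C1cov_pos d).le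
    ((differentiableOn_Ccov_insCfg hL hV₀ hβ0 hβ hβmax S q κ).mono (ball_subset_ball (by linarith [c3_pos d hL])))
    (fun a ha => norm_Ccov_insCfg_le hL hV₀ hβ0 hβ hβmax S q κ (le_of_lt (by rwa [mem_ball_zero_iff] at ha)))
  rwa [show c3 d L / 2 / 2 = c3 d L / 4 by ring] at h

/-! ## §3 (148) verbatim: fields on the whole lattice, `Q″` over `b ⊂ B(c₋) ∪ B(c₊)` -/

omit hV₀ hβ0 hβ hβmax [NormOneClass 𝔸] in
/-- **The differential (137) of `A ↦ C(V₀, A, c)` on the whole lattice sees the variation only on `B(c₋) ∪ B(c₊)`**: it equals the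
differential of the `𝔸^{S1}`-function of §2 at the restrictions `A|_{S1}`, `δA|_{S1}` (§1 along the line `A + tδA`; the global field
space `ℤ^d × Fin d → 𝔸` carries no norm, so (137) is Mathlib's `lineDeriv`). [cite: Balaban1985Averaging, (137) p.39, p.34] -/
theorem lineDeriv_Ccov_eq_dPair (q : Site d) (κ : Fin d) (A δA : Site d → Fin d → 𝔸) :
    lineDeriv ℂ (fun F : Site d → Fin d → 𝔸 => Ccov L V₀ F q κ) A δA
      = dPair (fun a : ↥(S1 L q κ) → 𝔸 => Ccov L V₀ (insCfg (S1 L q κ) a) q κ)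
          (restr (S1 L q κ) A) (restr (S1 L q κ) δA) := by
  unfold lineDeriv dPair
  have h : (fun t : ℂ => Ccov L V₀ (A + t • δA) q κ)
      = fun t : ℂ => Ccov L V₀ (insCfg (S1 L q κ) (restr (S1 L q κ) A + t • restr (S1 L q κ) δA)) q κ :=
    funext fun t => by rw [Ccov_eq_ins L hL V₀ (A + t • δA) q κ, restr_add_smul]
  rw [h]

/-- **(148) VERBATIM AT A GENERAL REGULAR BACKGROUND, FOR FIELDS ON THE WHOLE LATTICE** («|⟨δC(V₀, A)∕δA, δA⟩| ≤ C″₁|A|Q″|δA|», (140)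
«(Q″A)_c = Σ_{b ⊂ B(c₋)∪B(c₊)} L^{−d} A_b»): `‖A_b‖ ≤ a < c₃(d, L)∕4` on the bonds of `B(c₋) ∪ B(c₊)` (nothing asked elsewhere), ANY `δA`:
`‖dC(V₀, A; δA)(c)‖ ≤ 4C₁L^{d+2}·a·Σ_{b ⊂ B(c₋)∪B(c₊)} L^{−d}‖δA_b‖` — `Q″` summed over EXACTLY those bonds (`Qpp` on `restr (S1 L q κ) δA`).
[cite: Balaban1985Averaging, (148) p.40, (140) p.39, (137) p.39] -/
theorem ineq148_general_global (q : Site d) (κ : Fin d) (A δA : Site d → Fin d → 𝔸) {a : ℝ} (ha0 : 0 ≤ a)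
    (hA : ∀ x μ, BondIn q (bondHi L q κ) x μ → ‖A x μ‖ ≤ a) (hac : a < c3 d L / 4) :
    ‖lineDeriv ℂ (fun F : Site d → Fin d → 𝔸 => Ccov L V₀ F q κ) A δA‖
      ≤ 4 * C1cov d * (L : ℝ) ^ (d + 2) * a * Qpp (L : ℝ) d (restr (S1 L q κ) δA) := by
  have hL0 : (0 : ℝ) ≤ L := by exact_mod_cast (Nat.zero_le L)
  have hnA : ‖restr (S1 L q κ) A‖ ≤ a := (pi_norm_le_iff_of_nonneg ha0).2 fun s => hA _ _ (mem_bondsIn.1 s.2)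
  rw [lineDeriv_Ccov_eq_dPair hL q κ A δA]
  refine (ineq148_general hL hV₀ hβ0 hβ hβmax (S1 L q κ) q κ (restr (S1 L q κ) A) (hnA.trans_lt hac)
    (restr (S1 L q κ) δA)).trans ?_
  have hC : 0 ≤ 4 * C1cov d * (L : ℝ) ^ (d + 2) := by have := C1cov_pos d; positivity
  exact mul_le_mul_of_nonneg_right (mul_le_mul_of_nonneg_left hnA hC) (Qpp_nonneg _ _ hL0 _)

end Ineq148

/-! ## §4 END-II's Landau correction `landauCf` (row S64) is block-local: its derivative kernel vanishes off `B^k(c₋) ∪ B^k(c₊)` -/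

section Landau

variable {𝔸 : Type*} [NormedRing 𝔸] [NormedAlgebra ℂ 𝔸] [CompleteSpace 𝔸]

omit [CompleteSpace 𝔸] in
/-- Two variable vectors `A`, `A′ ∈ 𝔸^S` agreeing on the variables inside a box give scaled insertions (`ηA` on `S`, `0` off `S`)
agreeing on the bonds of that box. [folklore] -/
theorem agreeOn_scaleIns (L k : ℕ) (S : Finset (Site d × Fin d)) {lo hi : Site d} {A A' : S → 𝔸}
    (h : ∀ s : S, BondIn lo hi s.1.1 s.1.2 → A s = A' s) : AgreeOn lo hi (scaleIns L k S A) (scaleIns L k S A') := by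
  intro x μ hx hxe
  unfold scaleIns insCfg
  by_cases hm : (x, μ) ∈ S
  · simp only [hm, dite_true, Pi.smul_apply, h ⟨(x, μ), hm⟩ ⟨hx, hxe⟩]
  · simp only [hm, dite_false]

/-- **END-II's `Cf` IS BLOCK-LOCAL**: row S64's `landauCf L U₀ k S S′ A (c)` — (134) «C_k(U₀, A)» read on the `Lᵏ`-bond
`c = ⟨Lᵏz, Lᵏz + Lᵏe_κ⟩` — depends on the variables `A_b` only for `b ⊂ B^k(c₋) ∪ B^k(c₊)` (p. 38: «Q_k(U₀, ηA, c) … is an analytic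
function of the variables A_b, b ⊂ B^k(c₋)∪B^k(c₊)»; §1 `logCovIter_congr` − `linCovIter_congr`). [cite: Balaban1985Averaging, p.38 (Proposition 4), p.31 (after (91)), (134) p.38] -/
theorem landauCf_congr {L : ℕ} (hL : 1 ≤ L) (U₀ : Site d → Fin d → 𝔸ˣ) (k : ℕ) (S S' : Finset (Site d × Fin d))
    {A A' : S → 𝔸} (c : S')
    (h : ∀ s : S, BondIn (loK L k c.1.1) (bondHiK L k c.1.1 c.1.2) s.1.1 s.1.2 → A s = A' s) :
    landauCf L U₀ k S S' A c = landauCf L U₀ k S S' A' c := by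
  unfold landauCf
  rw [logCovIter_congr L hL k c.1.1 c.1.2 agreeOn_rfl (agreeOn_scaleIns L k S h),
    linCovIter_congr L hL k c.1.1 c.1.2 agreeOn_rfl (agreeOn_scaleIns L k S h)]

/-- **THE DERIVATIVE KERNEL OF `Cf` VANISHES OFF THE BOX** (differential form): for `b ∈ S` NOT contained in `B^k(c₋) ∪ B^k(c₊)` and any
`X ∈ 𝔸`, the differential (137) of `A ↦ C_k(U₀, A)(c)` in the direction `X·δ_b` is `0` — the exact-support half of the pseudo-locality
[Balaban1985Variational] (73) displays for `𝔇(A′; c, b)`. [cite: Balaban1985Averaging, p.38 (Proposition 4), (137) p.39] -/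
theorem dPair_landauCf_apply_eq_zero {L : ℕ} (hL : 1 ≤ L) (U₀ : Site d → Fin d → 𝔸ˣ) (k : ℕ)
    (S S' : Finset (Site d × Fin d)) [DecidableEq ↥S] (A : S → 𝔸) (c : S') (b : S)
    (hb : ¬ BondIn (loK L k c.1.1) (bondHiK L k c.1.1 c.1.2) b.1.1 b.1.2) (X : 𝔸) :
    dPair (fun A' : S → 𝔸 => landauCf L U₀ k S S' A' c) A (Pi.single b X : S → 𝔸) = 0 := by
  unfold dPair
  have h : (fun t : ℂ => landauCf L U₀ k S S' (A + t • (Pi.single b X : S → 𝔸)) c)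
      = fun _ => landauCf L U₀ k S S' A c := by
    funext t
    refine landauCf_congr hL U₀ k S S' c fun s hs => ?_
    have hsb : s ≠ b := fun hsb => hb (hsb ▸ hs)
    simp only [Pi.add_apply, Pi.smul_apply, Pi.single_apply, if_neg hsb, smul_zero, add_zero]
  rw [h, deriv_const]

/-- **… in Fréchet form**: wherever `Cf = landauCf L U₀ k S S′` is `ℂ`-differentiable (row S64 `differentiableOn_landauCf`), the entry
`(c, b)` of its derivative, `D Cf(A)(X·δ_b)(c)`, is `0` for every `b` off `B^k(c₋) ∪ B^k(c₊)`, every `k`. [cite: Balaban1985Averaging, p.38 (Proposition 4), (157) p.42] -/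
theorem fderiv_landauCf_apply_single_eq_zero {L : ℕ} (hL : 1 ≤ L) (U₀ : Site d → Fin d → 𝔸ˣ) (k : ℕ)
    (S S' : Finset (Site d × Fin d)) [DecidableEq ↥S] {A : S → 𝔸}
    (hd : DifferentiableAt ℂ (landauCf L U₀ k S S') A) (c : S') (b : S)
    (hb : ¬ BondIn (loK L k c.1.1) (bondHiK L k c.1.1 c.1.2) b.1.1 b.1.2) (X : 𝔸) :
    fderiv ℂ (landauCf L U₀ k S S') A (Pi.single b X) c = 0 := by
  have hg : HasFDerivAt (fun A' : S → 𝔸 => landauCf L U₀ k S S' A' c)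
      ((ContinuousLinearMap.proj (R := ℂ) (φ := fun _ : ↥S' => 𝔸) c).comp (fderiv ℂ (landauCf L U₀ k S S') A)) A :=
    (ContinuousLinearMap.proj (R := ℂ) (φ := fun _ : ↥S' => 𝔸) c).hasFDerivAt.comp A hd.hasFDerivAt
  have h1 := dPair_eq_fderiv hg.differentiableAt (Pi.single b X : S → 𝔸)
  rw [dPair_landauCf_apply_eq_zero hL U₀ k S S' A c b hb X, hg.fderiv] at h1
  simpa using h1.symm

end Landau

end Summit.QuantumFields.BalabanUV.T4Continuum.ShellMeasureAverageLocality148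

end
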